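import Summits.HodgeConjecture.HodgeConjecture.Theorems.F0P6aModuliDatum
import HarnessLib
import HarnessLib.Audit.LibrarySuggestionsDenyListCruxes

/-!
# F0_P6a_ModuliDatum — ED. 11 = SHIM (K6 «MAIN + PARENT» row, LAST wave; rung-0 re-home, LEAD «M-72» (4)∕«M-140»∕«M-147d»; desk F0P6a-plan (g7) cand v10, written only on the LEAD heir՚s wave word)

Every declaration of the tree workfile `Lines/F0_P6a_ModuliDatum.lean` (ED. 10 (S1), sha16 adc1f6959b94cbf0, 794 l., code-`sorry`-free, 0 sockets; 16 declarations)
now lives, byte for byte and under the SAME namespace `Summit.HodgeConjecture.HodgeConjecture.Cruxes.HLiu418.F0P6aModuliDatum`, in the ★ chain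
`Theorems/F0P6aModuliDatumLetters.lean` → `Theorems/F0P6aModuliDatumLayers.lean` → `Theorems/F0P6aModuliDatum.lean` (LAST part = plain stem; each part imports the previous); this module keeps its name so that its tree importers
(parent `Lines/F0_D9opRoad2.lean` :90 `F0P6aModuliDatum.pwcore_holds` (FQN kept ★-side ⇒ resolves through the import; no alias needed)) and any by-name reader resolve unchanged through the import above.
It declares nothing.  No declaration was cut in the ★ twin (verbatim re-home) ⇒ nothing to alias.
CLOSURE-NAMES («M-146a» (2)): ∅ — members = tree rev-closure {`F0_AlbCm`} (MAIN ← `F0_D9opRoad2` ← `F0_AlbCm` ← ∅); with the MAIN ED. 11 and parent ED. 9 shims applied jointly no departed `Lines`-only name occurs in the member՚s code (desk leg `F0/P6/F0P6a-plan/g7/cn/closure_names.py`).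
ORDER NOTE: written in ONE request with the parent∕MAIN shim and the socket `F0_AlbCm` as rider∕named importer, on the LEAD՚s word, after EVERY ★ part above is ACCEPTED (NO-CROSS-IMPORT: no environment may hold
a `Lines/` ORIGINAL together with its ★ twin); an importer smoke that reads «environment already contains …» before that request is BUILT is this order note, not a defect.
Edition history stays in the line card `Lines/F0_P6a_ModuliDatum.md` and in git; future changes are ★-side proposals on the `Theorems/` files.
HC_CM is proved only modulo the printed citations (2 remaining named inputs: hLiu418 = stmt-HodgeConjecture-24832, h413 = stmt-HodgeConjecture-24833) until rung 0 closes; a re-home is count-neutral. (0 `sorry`, 0 socket, 0 declarations). -/
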